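import Summits.CriticalPhenomena.PercolationContinuityZ3.Theorems.PercNearOneGluingNoHeavyPcintClosingWordDiagram
import HarnessLib

/-!
# CriticalPhenomena/PercolationContinuityZ3 — Theorems/PercNearOneGluingNoHeavyPcintClosingWordStructure.lean: a return word on `m` axes has length `≥ 2m − 1`, and at length `2m − 1` it IS a chord diagram (combinatorial core of STRUCTURE law C5-L1, part 5)

Lane prim-pcint, STRUCTURE rule «numerics ⇒ structure ⇒ conjecture» (prim-pcint-2 GEN 20); sequel of …PcintClosingWordDiagram.
Counting letters by axis and sign (`uses`, `cnt`): a word of length `n` on `ℤ^j` that uses every axis and ends within `ℓ¹`-distance `1` of the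
origin satisfies `2j ≤ n + 1` (`two_mul_le_of_full`: each axis contributes `uses + |coordinate| ≥ 2`), whence
**`fullClosingCount j (2m) = 0` for `j > m`** (`fullClosingCount_eq_zero_of_gt`); and in the extremal case `n + 1 = 2j` exactly one axis is used
once and every other axis exactly once in each direction (`structure_of_full`).  Consequently such a word is COMPATIBLE with a chord diagram on
its letters plus the virtual closing point (`exists_isDiag_compat`: partner = the position of the reversed letter, the once-used letter being
partnered with the closing point).  With …PcintClosingWordDiagram this makes the extremal closing words exactly the labelled oriented irreducible
chord diagrams; the count is completed in …PcintClosingWordCount.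

HONEST FRAMING: elementary finite combinatorics written for the proof of `polygonLeadingCoeffLaw` (all `m`).  No `sorry`; standard axioms.
Written by prim-pcint-2 gen 20 (prover-prim-pcint-2-g20-0), 2026-08-26.
-/

noncomputable section

namespace Summit.CriticalPhenomena.PercolationContinuityZ3.Theorems.Pcint.ChordDiag

open Literature.Probability.LatticeModels Literature.Probability.Percolation
open Summit.CriticalPhenomena.PercolationContinuityZ3.Theorems.Pcint
open Summit.CriticalPhenomena.PercolationContinuityZ3.Theorems.Pcint.MemoryTail

variable {n j : ℕ}

/-! ### Counting letters by axis and sign -/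

/-- The number of letters `(c, b)` in `w`. [folklore] -/
def cnt (w : Fin n → Fin j × Bool) (c : Fin j) (b : Bool) : ℕ := (Finset.univ.filter fun t => w t = (c, b)).card

/-- The number of letters of `w` on the axis `c`. [folklore] -/
def uses (w : Fin n → Fin j × Bool) (c : Fin j) : ℕ := (Finset.univ.filter fun t => (w t).1 = c).card

/-- Every letter lies on one axis: `Σ_c uses w c = n`. [folklore] -/
theorem sum_uses (w : Fin n → Fin j × Bool) : ∑ c, uses w c = n := by
  unfold uses
  rw [← Finset.card_eq_sum_card_fiberwise (s := Finset.univ) (t := Finset.univ) (f := fun t => (w t).1)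
    (fun _ _ => Finset.mem_univ _)]
  simp

/-- `uses = cnt true + cnt false`. [folklore] -/
theorem uses_eq (w : Fin n → Fin j × Bool) (c : Fin j) : uses w c = cnt w c true + cnt w c false := by
  unfold uses cnt
  rw [← Finset.card_filter_add_card_filter_not (s := Finset.univ.filter fun t => (w t).1 = c)
    (p := fun t => (w t).2 = true), Finset.filter_filter, Finset.filter_filter]
  congr 2
  · ext t
    simp only [Finset.mem_filter, Finset.mem_univ, true_and, Prod.ext_iff]
  · ext t
    simp only [Finset.mem_filter, Finset.mem_univ, true_and, Prod.ext_iff, Bool.not_eq_true]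

/-- Coordinates of a unit step as a difference of indicators. [folklore] -/
theorem stepVec_apply_eq_ite (a : Fin j × Bool) (c : Fin j) :
    stepVec a c = (if a = (c, true) then (1 : ℤ) else 0) - (if a = (c, false) then (1 : ℤ) else 0) := by
  obtain ⟨a1, a2⟩ := a
  rw [stepVec_apply]
  by_cases h : c = a1
  · subst h; cases a2 <;> simp
  · have h' : a1 ≠ c := fun e => h e.symm
    cases a2 <;> simp [h, h']

/-- **Coordinates of the endpoint**: `wordPos w n c = cnt (c, +) − cnt (c, −)`. [folklore] -/
theorem wordPos_apply_eq (w : Fin n → Fin j × Bool) (c : Fin j) :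
    wordPos w n c = (cnt w c true : ℤ) - (cnt w c false : ℤ) := by
  rw [wordPos_length_eq_sum, Finset.sum_apply]
  simp_rw [stepVec_apply_eq_ite]
  rw [Finset.sum_sub_distrib, Finset.sum_boole, Finset.sum_boole]
  rfl

/-- The `ℓ¹` norm of the endpoint, by axis. [folklore] -/
theorem l1_wordPos_eq (w : Fin n → Fin j × Bool) :
    l1 (wordPos w n) = ∑ c, ((cnt w c true : ℤ) - (cnt w c false : ℤ)).natAbs := by
  unfold l1
  exact Finset.sum_congr rfl fun c _ => by rw [wordPos_apply_eq]

/-- Each axis that is used contributes at least `2` to `uses + |coordinate|`. [folklore] -/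
theorem two_le_uses_add {w : Fin n → Fin j × Bool} {c : Fin j} (h : 1 ≤ uses w c) :
    2 ≤ uses w c + ((cnt w c true : ℤ) - (cnt w c false : ℤ)).natAbs := by
  rw [uses_eq] at h ⊢
  rcases eq_or_ne (cnt w c true) (cnt w c false) with he | hne
  · rw [he] at h ⊢; omega
  · have : ((cnt w c true : ℤ) - (cnt w c false : ℤ)) ≠ 0 := by
      intro h0; apply hne; exact_mod_cast sub_eq_zero.1 h0
    have := Int.natAbs_pos.2 this
    omega

/-! ### The length bound and the extremal structure -/

/-- **A return word using all `j` axes has length `≥ 2j − 1`.** [folklore] -/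
theorem two_mul_le_of_full {w : Fin n → Fin j × Bool} (hax : ∀ c, 1 ≤ uses w c) (hl1 : l1 (wordPos w n) ≤ 1) :
    2 * j ≤ n + 1 := by
  have h1 : ∑ c : Fin j, 2 ≤ ∑ c, (uses w c + ((cnt w c true : ℤ) - (cnt w c false : ℤ)).natAbs) :=
    Finset.sum_le_sum fun c _ => two_le_uses_add (hax c)
  rw [Finset.sum_const, Finset.card_univ, Fintype.card_fin, smul_eq_mul, Finset.sum_add_distrib, sum_uses,
    ← l1_wordPos_eq] at h1
  omega

/-- **Extremal structure**: at length `2j − 1` exactly one axis is used once and every other axis once in each direction. [folklore] -/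
theorem structure_of_full {w : Fin n → Fin j × Bool} (hax : ∀ c, 1 ≤ uses w c) (hl1 : l1 (wordPos w n) ≤ 1)
    (hn : n + 1 = 2 * j) : ∃ c₀, uses w c₀ = 1 ∧ ∀ c, c ≠ c₀ → cnt w c true = 1 ∧ cnt w c false = 1 := by
  set v : Fin j → ℕ := fun c => ((cnt w c true : ℤ) - (cnt w c false : ℤ)).natAbs with hv
  have hl : l1 (wordPos w n) = ∑ c, v c := l1_wordPos_eq w
  have hge : ∀ c, 2 ≤ uses w c + v c := fun c => two_le_uses_add (hax c)
  have hsum : ∑ c, (uses w c + v c) = n + l1 (wordPos w n) := by rw [Finset.sum_add_distrib, sum_uses, hl]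
  -- every axis contributes exactly `2`
  have heq : ∀ c, uses w c + v c = 2 := by
    by_contra h
    push Not at h
    obtain ⟨c₁, hc₁⟩ := h
    have hlt : ∑ c : Fin j, 2 < ∑ c, (uses w c + v c) :=
      Finset.sum_lt_sum (fun c _ => hge c) ⟨c₁, Finset.mem_univ _, lt_of_le_of_ne (hge c₁) (Ne.symm hc₁)⟩
    rw [Finset.sum_const, Finset.card_univ, Fintype.card_fin, smul_eq_mul, hsum] at hlt
    omega
  have hl1' : ∑ c, v c = 1 := by
    have := hsum
    rw [Finset.sum_congr rfl fun c _ => heq c, Finset.sum_const, Finset.card_univ, Fintype.card_fin, smul_eq_mul] at this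
    omega
  -- the axis with odd coordinate
  obtain ⟨c₀, -, hc₀⟩ := Finset.exists_ne_zero_of_sum_ne_zero (by rw [hl1']; exact one_ne_zero : ∑ c, v c ≠ 0)
  have hv0 : ∀ c, c ≠ c₀ → v c = 0 := by
    intro c hc
    have := Finset.sum_le_sum_of_subset_of_nonneg (f := v) (Finset.subset_univ {c, c₀}) (fun _ _ _ => Nat.zero_le _)
    rw [Finset.sum_pair hc, hl1'] at this
    omega
  refine ⟨c₀, ?_, fun c hc => ?_⟩
  · have h1 := heq c₀
    have h2 : v c₀ ≤ 1 := by rw [← hl1']; exact Finset.single_le_sum (fun _ _ => Nat.zero_le _) (Finset.mem_univ c₀)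
    omega
  · have h1 := heq c
    have h2 := hv0 c hc
    rw [uses_eq] at h1
    have h3 : cnt w c true = cnt w c false := by
      have := Int.natAbs_eq_zero.1 h2
      exact_mod_cast sub_eq_zero.1 this
    omega

/-- **`fullClosingCount j (2m) = 0` for `j > m`**: a `2m`-gon spans at most `m` axes. [folklore] -/
theorem fullClosingCount_eq_zero_of_gt {j m : ℕ} (h : m < j) : fullClosingCount j (2 * m) = 0 := by
  classical
  rcases Nat.eq_zero_or_pos m with rfl | hm
  · exact fullClosingCount_eq_zero_of_lt (by omega)
  unfold fullClosingCount
  rw [Finset.card_eq_zero, Finset.filter_eq_empty_iff]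
  intro w hw hax
  rw [mem_nearWords] at hw
  have huse : ∀ c, 1 ≤ uses w c := by
    intro c
    have hc : c ∈ axes w := by rw [hax]; exact Finset.mem_univ c
    unfold axes at hc
    obtain ⟨t, -, ht⟩ := Finset.mem_image.1 hc
    exact Finset.card_pos.2 ⟨t, Finset.mem_filter.2 ⟨Finset.mem_univ _, ht⟩⟩
  have := two_mul_le_of_full huse (hw.2.trans (by omega))
  omega

/-! ### The chord diagram of an extremal closing word -/

section Diagram

variable {w : Fin n → Fin j × Bool} {c₀ : Fin j}

/-- A letter occurring exactly once occurs at one position only. [folklore] -/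
theorem eq_of_cnt_eq_one {c : Fin j} {b : Bool} (h : cnt w c b = 1) {s t : Fin n} (hs : w s = (c, b)) (ht : w t = (c, b)) : s = t := by
  unfold cnt at h
  obtain ⟨u, hu⟩ := Finset.card_eq_one.1 h
  have hs' : s ∈ ({u} : Finset (Fin n)) := by rw [← hu]; exact Finset.mem_filter.2 ⟨Finset.mem_univ _, hs⟩
  have ht' : t ∈ ({u} : Finset (Fin n)) := by rw [← hu]; exact Finset.mem_filter.2 ⟨Finset.mem_univ _, ht⟩
  rw [Finset.mem_singleton] at hs' ht'
  rw [hs', ht']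

/-- A letter occurring exactly once occurs. [folklore] -/
theorem exists_of_cnt_eq_one {c : Fin j} {b : Bool} (h : cnt w c b = 1) : ∃ t, w t = (c, b) := by
  unfold cnt at h
  obtain ⟨u, hu⟩ := Finset.card_eq_one.1 h
  have : u ∈ Finset.univ.filter fun t => w t = (c, b) := by rw [hu]; exact Finset.mem_singleton_self u
  exact ⟨u, (Finset.mem_filter.1 this).2⟩

/-- An axis used exactly once is used at one position only. [folklore] -/
theorem eq_of_uses_eq_one (h : uses w c₀ = 1) {s t : Fin n} (hs : (w s).1 = c₀) (ht : (w t).1 = c₀) : s = t := by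
  unfold uses at h
  obtain ⟨u, hu⟩ := Finset.card_eq_one.1 h
  have hs' : s ∈ ({u} : Finset (Fin n)) := by rw [← hu]; exact Finset.mem_filter.2 ⟨Finset.mem_univ _, hs⟩
  have ht' : t ∈ ({u} : Finset (Fin n)) := by rw [← hu]; exact Finset.mem_filter.2 ⟨Finset.mem_univ _, ht⟩
  rw [Finset.mem_singleton] at hs' ht'
  rw [hs', ht']

/-- An axis used exactly once is used. [folklore] -/
theorem exists_of_uses_eq_one (h : uses w c₀ = 1) : ∃ s, (w s).1 = c₀ := by
  unfold uses at h
  obtain ⟨u, hu⟩ := Finset.card_eq_one.1 h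
  have : u ∈ Finset.univ.filter fun t => (w t).1 = c₀ := by rw [hu]; exact Finset.mem_singleton_self u
  exact ⟨u, (Finset.mem_filter.1 this).2⟩

/-- Off the lone axis the reversed letter occurs, at a unique position. [folklore] -/
theorem exists_srev (hct : ∀ c, c ≠ c₀ → cnt w c true = 1 ∧ cnt w c false = 1) {s : Fin n} (hs : (w s).1 ≠ c₀) :
    ∃ t, w t = srev (w s) := by
  have h := (hct _ hs)
  cases hb : (w s).2
  · obtain ⟨t, ht⟩ := exists_of_cnt_eq_one h.1
    exact ⟨t, by rw [ht]; ext <;> simp [srev, hb]⟩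
  · obtain ⟨t, ht⟩ := exists_of_cnt_eq_one h.2
    exact ⟨t, by rw [ht]; ext <;> simp [srev, hb]⟩

/-- Off the lone axis letters occur at unique positions. [folklore] -/
theorem eq_of_eq (hct : ∀ c, c ≠ c₀ → cnt w c true = 1 ∧ cnt w c false = 1) {s t : Fin n} (hs : (w s).1 ≠ c₀)
    (h : w t = w s) : t = s := by
  have h' := hct _ hs
  cases hb : (w s).2
  · exact eq_of_cnt_eq_one h'.2 (by rw [h]; ext <;> simp [hb]) (by ext <;> simp [hb])
  · exact eq_of_cnt_eq_one h'.1 (by rw [h]; ext <;> simp [hb]) (by ext <;> simp [hb])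

/-- On the lone axis no reversed letter occurs. [folklore] -/
theorem not_exists_srev (hc₀ : uses w c₀ = 1) {s : Fin n} (hs : (w s).1 = c₀) : ¬ ∃ t, w t = srev (w s) := by
  rintro ⟨t, ht⟩
  have hts : t = s := eq_of_uses_eq_one hc₀ (by rw [ht]; exact hs) hs
  rw [hts] at ht
  exact srev_ne_self (w s) ht.symm

/-- **An extremal closing word is compatible with a chord diagram** on its letters and the virtual closing point: partner = position of the
reversed letter, the once-used letter being partnered with the closing point. [folklore] -/
theorem exists_isDiag_compat_of (hc₀ : uses w c₀ = 1) (hct : ∀ c, c ≠ c₀ → cnt w c true = 1 ∧ cnt w c false = 1) :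
    ∃ π : Fin (n + 1) → Fin (n + 1), IsDiag π ∧ Compat π w := by
  classical
  -- the partner of a letter, and of the closing point
  let body : Fin n → Fin (n + 1) := fun s => if h : ∃ t, w t = srev (w s) then Fin.castSucc h.choose else Fin.last n
  obtain ⟨s₀, hs₀⟩ := exists_of_uses_eq_one hc₀
  let π : Fin (n + 1) → Fin (n + 1) := fun x => Fin.lastCases (Fin.castSucc s₀) body x
  have hπc : ∀ s, π (Fin.castSucc s) = body s := fun s => by simp only [π, Fin.lastCases_castSucc]
  have hπl : π (Fin.last n) = Fin.castSucc s₀ := by simp only [π, Fin.lastCases_last]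
  -- values of `body`
  have body_of_ne : ∀ {s : Fin n} (hs : (w s).1 ≠ c₀), ∃ t, w t = srev (w s) ∧ body s = Fin.castSucc t := by
    intro s hs
    have h := exists_srev hct hs
    exact ⟨h.choose, h.choose_spec, by simp only [body, dif_pos h]⟩
  have body_of_eq : ∀ {s : Fin n}, (w s).1 = c₀ → body s = Fin.last n := by
    intro s hs
    simp only [body, dif_neg (not_exists_srev hc₀ hs)]
  refine ⟨π, fun x => ?_, ⟨fun s t hst => ?_, fun s t hst hax => ?_⟩⟩
  · -- involution without fixed points
    induction x using Fin.lastCases with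
    | last =>
      rw [hπl, hπc, body_of_eq hs₀]
      exact ⟨rfl, (Fin.castSucc_lt_last s₀).ne⟩
    | cast s =>
      rw [hπc]
      by_cases hs : (w s).1 = c₀
      · rw [body_of_eq hs, hπl]
        exact ⟨by rw [eq_of_uses_eq_one hc₀ hs₀ hs], (Fin.castSucc_lt_last s).ne'⟩
      · obtain ⟨t, ht, hb⟩ := body_of_ne hs
        have hta : (w t).1 ≠ c₀ := by rw [ht]; exact hs
        obtain ⟨t', ht', hb'⟩ := body_of_ne hta
        rw [hb, hπc, hb']
        rw [ht, srev_srev] at ht'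
        refine ⟨by rw [eq_of_eq hct hs ht'], fun h => ?_⟩
        have := Fin.castSucc_injective _ h
        rw [this] at ht
        exact srev_ne_self (w s) ht.symm
  · -- partners carry reversed letters
    rw [hπc] at hst
    by_cases hs : (w s).1 = c₀
    · rw [body_of_eq hs] at hst
      exact absurd hst.symm (Fin.castSucc_lt_last t).ne
    · obtain ⟨t', ht', hb'⟩ := body_of_ne hs
      rw [hb'] at hst
      rw [← Fin.castSucc_injective _ hst]
      exact ht'
  · -- equal axes only at partners
    rw [hπc]
    have hs : (w s).1 ≠ c₀ := fun h => hst (eq_of_uses_eq_one hc₀ h (hax ▸ h))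
    obtain ⟨t', ht', hb'⟩ := body_of_ne hs
    rw [hb']
    congr 1
    -- `w t` is the reversed letter of `w s`
    have hwt : w t = srev (w s) := by
      have hne : (w t).2 ≠ (w s).2 := fun h2 => hst (eq_of_eq hct hs (Prod.ext hax.symm h2)).symm
      refine Prod.ext (by simpa [srev] using hax.symm) ?_
      simp only [srev]
      cases h1 : (w t).2 <;> cases h2 : (w s).2 <;> simp_all
    exact eq_of_eq hct (by rw [hwt]; exact hs) (by rw [ht', hwt])

end Diagram

/-- **Every extremal full closing word is compatible with some chord diagram.** [folklore] -/
theorem exists_isDiag_compat {w : Fin n → Fin j × Bool} (hax : ∀ c, 1 ≤ uses w c) (hl1 : l1 (wordPos w n) ≤ 1)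
    (hn : n + 1 = 2 * j) : ∃ π : Fin (n + 1) → Fin (n + 1), IsDiag π ∧ Compat π w := by
  obtain ⟨c₀, hc₀, hct⟩ := structure_of_full hax hl1 hn
  exact exists_isDiag_compat_of hc₀ hct

end Summit.CriticalPhenomena.PercolationContinuityZ3.Theorems.Pcint.ChordDiag
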